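/-
Copyright (c) 2026 the pub-hodgecm-mathlib formalisation cell (harness21).  Prover seat hodgecm-mathlib-K2E2-p12 (g4): Track B «K2-LIT», ENGINE E1,
h413 = stmt-HodgeConjecture-24833; FILE 3 of K2E1-plan (g4)'s «R7₂-SCALAR» (2026-09-04T06:53:00Z), part (3a): the one-variable (`ι`-free) Euler product of an integrable
factorizable function on `𝔸_{K,f}`.
-/
import Summits.HodgeConjecture.HodgeConjecture.Theorems.AdelicProductIntegral    -- ★ p858070 (this seat): Tate's Thm 3.3.1 for integrable factorizable functions on `(𝔸_{K,f})^ι`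
import HarnessLib

/-!
# `AdelicProductIntegralOne`: THE EULER PRODUCT OF AN INTEGRABLE FACTORIZABLE FUNCTION ON `𝔸_{K,f}` (ONE VARIABLE) —
# `∏'_v ν_v(𝒪_v)⁻¹·∫_{K_v} f_v dν_v = μ(𝒪̂)⁻¹·∫_{𝔸_{K,f}} ∏ᶠ_v f_v(b_v) dμ(b)`

Track B ∕ K2-LIT, crux h413 = `stmt-HodgeConjecture-24833`, route of record `HCCMUnconditional`; cell `hodgecm-mathlib`, squad K2, ENGINE E1 (campaign «EIS-RANK-ONE», R7₂ FILE 3, part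
(3a)).  THEOREMS ONLY (no `def`, no instance, no notation, no named-fact hypothesis, no `sorry`; default heartbeats); lane `--supports stmt-HodgeConjecture-24833 --as helper` (count-neutral).
GENERIC: any number field `K`, any additive Haar measures `μ` on `𝔸_{K,f}` and `ν_v` on the `K_v`.

THE MATHEMATICS [TateThesis1967, Thm 3.3.1; WeilBNT1967, Ch. VII §4 Prop. 10].  ★ `AdelicProductIntegral.hasProd_localIntegral_of_integrable` (p858070) is stated on `(𝔸_{K,f})^ι` for a
finite index type `ι` (the currency of ★ `FiniteAdelePureTensorIntegral`).  This file is its ONE-VARIABLE read (`ι = Unit`), transported along Mathlib's measure-preserving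
`MeasurableEquiv.funUnique : (Unit → X) ≃ᵐ X` (`Measure.pi (fun _ ↦ μ) ↦ μ`, `measurePreserving_funUnique`): for continuous `f_v : K_v → ℂ` with `f_v = 1` on `𝒪_v` off a finset `S₀`
and `F(b) = ∏ᶠ_v f_v(b_v)` `μ`-integrable, the local means `a_v = ν_v(𝒪_v)⁻¹·∫ f_v dν_v` are multipliable with **`∏'_v a_v = μ(𝒪̂)⁻¹·∫ F dμ`** as a `HasProd`
(`𝒪̂ = {b | b_v ∈ 𝒪_v ∀ v}`), plus the `tprod` and the Tate-normalised (`μ(𝒪̂) = ν_v(𝒪_v) = 1`) forms.  Consumer: FILE 3 `K2E1IntertwiningScalarEulerProductU2` (the finite part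
`∫_{𝔸_{L⁺,f}} h_f(b)^{−σ} dμ_f` of the `U(J₂)` intertwining scalar).
HONEST LABEL: HC_CM is proved only modulo the 7 printed citations (2 remaining named inputs: hLiu418 = `stmt-HodgeConjecture-24832`, h413 = `stmt-HodgeConjecture-24833`) until rung 0
closes; this file asserts no named fact and closes no socket; count-neutral.

## References
* [TateThesis1967] J. Tate, *Fourier analysis in number fields and Hecke's zeta-functions*, in Cassels–Fröhlich (1967), §3.3, Thm 3.3.1, Lemma 3.3.2.
* [WeilBNT1967] A. Weil, *Basic Number Theory* (1967), Ch. VII §4, Prop. 10.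
-/

set_option autoImplicit false
set_option linter.dupNamespace false -- the mandated namespace repeats `HodgeConjecture.HodgeConjecture`

noncomputable section

open scoped ENNReal NNReal
open Function Set IsDedekindDomain NumberField MeasureTheory Topology Filter
open Literature.NumberTheory.Automorphic
open Summit.HodgeConjecture.HodgeConjecture.Cruxes.H413.AdelicProductIntegral

namespace Summit.HodgeConjecture.HodgeConjecture.Cruxes.H413.AdelicProductIntegralOne

variable (K : Type) [Field K] [NumberField K]
  [MeasurableSpace (FiniteAdeleRing (𝓞 K) K)] [BorelSpace (FiniteAdeleRing (𝓞 K) K)]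
  [∀ v : HeightOneSpectrum (𝓞 K), MeasurableSpace (v.adicCompletion K)] [∀ v : HeightOneSpectrum (𝓞 K), BorelSpace (v.adicCompletion K)]
  (μ : Measure (FiniteAdeleRing (𝓞 K) K)) [μ.IsAddHaarMeasure]
  (ν : ∀ v : HeightOneSpectrum (𝓞 K), Measure (v.adicCompletion K)) [∀ v, (ν v).IsAddHaarMeasure]
  (f : ∀ v : HeightOneSpectrum (𝓞 K), v.adicCompletion K → ℂ) (S₀ : Finset (HeightOneSpectrum (𝓞 K)))

/-! ## §1 The one-variable boxes through `funUnique` -/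

omit [BorelSpace (FiniteAdeleRing (𝓞 K) K)] [∀ v : HeightOneSpectrum (𝓞 K), MeasurableSpace (v.adicCompletion K)]
  [∀ v : HeightOneSpectrum (𝓞 K), BorelSpace (v.adicCompletion K)] in
/-- `offBox ∅` on `(𝔸_{K,f})^{Unit}` is the preimage of `𝒪̂ = {b | b_v ∈ 𝒪_v ∀ v}` under `funUnique`. [cite: TateThesis1967, §3.3] -/
theorem offBox_empty_eq_preimage :
    offBox (K := K) (ι := Unit) ∅ = (MeasurableEquiv.funUnique Unit (FiniteAdeleRing (𝓞 K) K)) ⁻¹' {b | ∀ v, b v ∈ v.adicCompletionIntegers K} := by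
  ext x
  simp only [offBox, Finset.notMem_empty, not_false_eq_true, forall_const, mem_setOf_eq, mem_preimage, MeasurableEquiv.funUnique_apply]
  exact ⟨fun h v => h () v, fun h i v => by cases i; exact h v⟩

omit [MeasurableSpace (FiniteAdeleRing (𝓞 K) K)] [BorelSpace (FiniteAdeleRing (𝓞 K) K)] [∀ v : HeightOneSpectrum (𝓞 K), BorelSpace (v.adicCompletion K)] in
/-- `integralBox K Unit v` is the preimage of `𝒪_v` under `funUnique`. [cite: TateThesis1967, §3.3] -/
theorem integralBox_eq_preimage (v : HeightOneSpectrum (𝓞 K)) :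
    integralBox K Unit v = (MeasurableEquiv.funUnique Unit (v.adicCompletion K)) ⁻¹' (v.adicCompletionIntegers K : Set (v.adicCompletion K)) := by
  ext z
  rw [mem_integralBox_iff, mem_preimage, MeasurableEquiv.funUnique_apply, SetLike.mem_coe]
  exact ⟨fun h => h (), fun h i => by cases i; exact h⟩

omit [∀ v : HeightOneSpectrum (𝓞 K), MeasurableSpace (v.adicCompletion K)] [∀ v : HeightOneSpectrum (𝓞 K), BorelSpace (v.adicCompletion K)] [μ.IsAddHaarMeasure] in
/-- `(Measure.pi fun _ ↦ μ)(offBox ∅) = μ(𝒪̂)`. [cite: TateThesis1967, §3.3] -/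
theorem measure_pi_offBox_empty :
    (Measure.pi fun _ : Unit => μ) (offBox (K := K) (ι := Unit) ∅) = μ {b | ∀ v, b v ∈ v.adicCompletionIntegers K} := by
  rw [offBox_empty_eq_preimage]
  refine (measurePreserving_funUnique μ Unit).measure_preimage ?_
  have h : {b : FiniteAdeleRing (𝓞 K) K | ∀ v, b v ∈ v.adicCompletionIntegers K} = (MeasurableEquiv.funUnique Unit (FiniteAdeleRing (𝓞 K) K)).symm ⁻¹' offBox (K := K) (ι := Unit) ∅ := by
    ext b
    simp only [offBox, Finset.notMem_empty, not_false_eq_true, forall_const, mem_setOf_eq, mem_preimage]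
    exact ⟨fun h _ v => h v, fun h v => h () v⟩
  rw [h]
  exact ((isOpen_offBox (K := K) (ι := Unit) ∅).measurableSet.preimage (MeasurableEquiv.funUnique Unit (FiniteAdeleRing (𝓞 K) K)).symm.measurable).nullMeasurableSet

omit [MeasurableSpace (FiniteAdeleRing (𝓞 K) K)] [BorelSpace (FiniteAdeleRing (𝓞 K) K)] [∀ v, (ν v).IsAddHaarMeasure] in
/-- `(Measure.pi fun _ ↦ ν_v)(𝒪_v^{Unit}) = ν_v(𝒪_v)`. [cite: TateThesis1967, §3.3] -/
theorem measure_pi_integralBox (v : HeightOneSpectrum (𝓞 K)) :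
    (Measure.pi fun _ : Unit => ν v) (integralBox K Unit v) = ν v (v.adicCompletionIntegers K) := by
  rw [integralBox_eq_preimage]
  exact (measurePreserving_funUnique (ν v) Unit).measure_preimage
    (Valued.isOpen_valuationSubring (v.adicCompletion K)).measurableSet.nullMeasurableSet

/-! ## §2 MAIN: the one-variable Euler product -/

/-- **TATE'S THEOREM 3.3.1 ON `𝔸_{K,f}` (ONE VARIABLE).**  Let `f_v : K_v → ℂ` be continuous with `f_v = 1` on `𝒪_v` for `v ∉ S₀`, and suppose `F(b) = ∏ᶠ_v f_v(b_v)` is `μ`-integrable.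
Then `a_v = ν_v(𝒪_v)⁻¹·∫ f_v dν_v` are multipliable and **`∏'_v a_v = μ(𝒪̂)⁻¹·∫ F dμ`** as a `HasProd` (★ p858070 at `ι = Unit`, transported along the measure-preserving `funUnique`).
[cite: TateThesis1967, Thm 3.3.1, Lemma 3.3.2] [cite: WeilBNT1967, Ch. VII §4 Prop. 10] -/
theorem hasProd_localIntegral_of_integrable_one (hcont : ∀ v, Continuous (f v)) (hf1 : ∀ v ∉ S₀, ∀ z ∈ v.adicCompletionIntegers K, f v z = 1)
    (hint : Integrable (fun b : FiniteAdeleRing (𝓞 K) K => ∏ᶠ v, f v (b v)) μ) :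
    HasProd (fun v : HeightOneSpectrum (𝓞 K) => (ν v (v.adicCompletionIntegers K)).toReal⁻¹ • ∫ z, f v z ∂ν v)
      ((μ {b | ∀ v, b v ∈ v.adicCompletionIntegers K}).toReal⁻¹ • ∫ b, (∏ᶠ v, f v (b v)) ∂μ) := by
  haveI : SecondCountableTopology (FiniteAdeleRing (𝓞 K) K) := secondCountableTopology_finiteAdeleRing K
  haveI : LocallyCompactSpace (FiniteAdeleRing (𝓞 K) K) := locallyCompactSpace_finiteAdeleRing' K
  haveI : ∀ v : HeightOneSpectrum (𝓞 K), SecondCountableTopology (v.adicCompletion K) := fun v => secondCountableTopology_adicCompletion K v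
  -- ★ p858070 at `ι = Unit` with the transported data
  have hμ := measurePreserving_funUnique μ Unit
  have hν : ∀ v, MeasurePreserving (MeasurableEquiv.funUnique Unit (v.adicCompletion K)) (Measure.pi fun _ : Unit => ν v) (ν v) :=
    fun v => measurePreserving_funUnique (ν v) Unit
  have h := hasProd_localIntegral_of_integrable K Unit (Measure.pi fun _ : Unit => μ) (fun v => Measure.pi fun _ : Unit => ν v)
    (fun v z => f v (z ())) S₀ (fun v => (hcont v).comp (continuous_apply ())) (fun v hv z hz => hf1 v hv _ (mem_integralBox_iff.1 hz ()))
    (by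
      have e := (hμ.integrable_comp_emb (MeasurableEquiv.funUnique Unit (FiniteAdeleRing (𝓞 K) K)).measurableEmbedding (g := fun b => ∏ᶠ v, f v (b v))).2 hint
      exact e)
  -- identify every transported quantity
  have e1 : ∀ v, ∫ z, f v (z ()) ∂(Measure.pi fun _ : Unit => ν v) = ∫ z, f v z ∂ν v := fun v =>
    (hν v).integral_comp (MeasurableEquiv.funUnique Unit (v.adicCompletion K)).measurableEmbedding (f v)
  have e2 : ∫ x, (∏ᶠ v, f v (x () v)) ∂(Measure.pi fun _ : Unit => μ) = ∫ b, (∏ᶠ v, f v (b v)) ∂μ :=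
    hμ.integral_comp (MeasurableEquiv.funUnique Unit (FiniteAdeleRing (𝓞 K) K)).measurableEmbedding (fun b => ∏ᶠ v, f v (b v))
  simp only [measure_pi_integralBox, e1, measure_pi_offBox_empty, e2] at h
  exact h

/-- **`∫ F dμ = μ(𝒪̂) · ∏'_v a_v`** (the `tprod` form) under the same hypotheses. [cite: TateThesis1967, Thm 3.3.1] -/
theorem integral_finprod_eq_mul_tprod_one (hcont : ∀ v, Continuous (f v)) (hf1 : ∀ v ∉ S₀, ∀ z ∈ v.adicCompletionIntegers K, f v z = 1)
    (hint : Integrable (fun b : FiniteAdeleRing (𝓞 K) K => ∏ᶠ v, f v (b v)) μ) :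
    Multipliable (fun v : HeightOneSpectrum (𝓞 K) => (ν v (v.adicCompletionIntegers K)).toReal⁻¹ • ∫ z, f v z ∂ν v) ∧
    ∫ b, (∏ᶠ v, f v (b v)) ∂μ =
      (μ {b | ∀ v, b v ∈ v.adicCompletionIntegers K}).toReal • ∏' v : HeightOneSpectrum (𝓞 K), ((ν v (v.adicCompletionIntegers K)).toReal⁻¹ • ∫ z, f v z ∂ν v) := by
  haveI : SecondCountableTopology (FiniteAdeleRing (𝓞 K) K) := secondCountableTopology_finiteAdeleRing K
  haveI : LocallyCompactSpace (FiniteAdeleRing (𝓞 K) K) := locallyCompactSpace_finiteAdeleRing' K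
  haveI : ∀ v : HeightOneSpectrum (𝓞 K), SecondCountableTopology (v.adicCompletion K) := fun v => secondCountableTopology_adicCompletion K v
  have h := hasProd_localIntegral_of_integrable_one K μ ν f S₀ hcont hf1 hint
  have hc0 : (μ {b : FiniteAdeleRing (𝓞 K) K | ∀ v, b v ∈ v.adicCompletionIntegers K}).toReal ≠ 0 := by
    rw [← measure_pi_offBox_empty]
    exact ENNReal.toReal_ne_zero.mpr ⟨(measure_offBox_empty_pos K Unit _).ne', (measure_offBox_empty_lt_top K Unit _).ne⟩
  refine ⟨h.multipliable, ?_⟩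
  rw [h.tprod_eq, ← smul_assoc, smul_eq_mul, mul_inv_cancel₀ hc0, one_smul]

/-- **Tate-normalised form `∫ ∏ᶠ_v f_v = ∏'_v ∫ f_v`** when `μ(𝒪̂) = 1` and `ν_v(𝒪_v) = 1` for all `v`. [cite: TateThesis1967, §3.3, Thm 3.3.1] -/
theorem hasProd_integral_of_measure_eq_one (hμ : μ {b | ∀ v, b v ∈ v.adicCompletionIntegers K} = 1) (hν : ∀ v, ν v (v.adicCompletionIntegers K) = 1)
    (hcont : ∀ v, Continuous (f v)) (hf1 : ∀ v ∉ S₀, ∀ z ∈ v.adicCompletionIntegers K, f v z = 1)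
    (hint : Integrable (fun b : FiniteAdeleRing (𝓞 K) K => ∏ᶠ v, f v (b v)) μ) :
    HasProd (fun v : HeightOneSpectrum (𝓞 K) => ∫ z, f v z ∂ν v) (∫ b, (∏ᶠ v, f v (b v)) ∂μ) := by
  have h := hasProd_localIntegral_of_integrable_one K μ ν f S₀ hcont hf1 hint
  simp only [hμ, hν, ENNReal.toReal_one, inv_one, one_smul] at h
  exact h

end Summit.HodgeConjecture.HodgeConjecture.Cruxes.H413.AdelicProductIntegralOne

end
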